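import Summits.QuantumFields.BalabanUV.T4Continuum.Support.GaugeTermPerturbationLaw
import Summits.QuantumFields.BalabanUV.T4Continuum.Support.GaugeTermCoercivity
import Summits.QuantumFields.BalabanUV.T4Continuum.Support.ScalarCovariantLaplacian
import Summits.QuantumFields.BalabanUV.T4Continuum.Support.ScalarAveragedCompression
import Summits.QuantumFields.BalabanUV.T4Continuum.Support.CovariantDivergencePlantingTower
import Summits.QuantumFields.BalabanUV.T4Continuum.Support.ScalarPlantingDefect

/-!
# T⁴ programme, spine node NE2 (U1a), tier B row B4.b — THE SCALAR DATA OF THE GAUGE TERM: Bałaban's transported scalar averaging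
# `Q′(U) = B·siteMul T` and King's 0-form planting `J₀` in the layer vocabulary, the exact identifications with rows B4.c/B4.d/B4.e/B4.f,
# and the FREE family's `LayerLaws` from the `U = 1` scalar tower

ROUND-2 swarm `t4-ne2-formalise-*`, leaf prover 05, row **B4.b**, wiring file 1 of 2 (row files: `GaugeTermSandwichLaw` p207779,
`GaugeTermResolventBounds` p208240, `GaugeTermTwoLevelNumbers` p208302, `GaugeTermLayer` p208738, `GaugeTermPerturbationLaw` p208973,
`GaugeTermCoercivity` p209121).  The END `perturbationLaws_gaugeTerm` takes two `LayerLaws` bundles of NUMBERS.  Here the DATA are fixed to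
the suppliers' typed objects and the FREE family's bundle is produced:
 * §1 the data: `QuT T k := Bs o n_k M · siteMul (T k)` (leaf-01's transported scalar averaging, [Balaban1985BackgroundPropagators] (3.19)
   p.393 shape; site transporters `T` DATA), `Q1 k := Bs o n_k M` (`= Qiso ⊗ 1`, leaf-09), `J0 k := JK0T L M k ⊗ₖ 1` (King's 0-form
   planting retyped along the tower, leaf-10 = leaf-04's `ScalarBlockPlanting.JK0` by `JK0_eq_planting`);
 * §2 EXACT IDENTIFICATIONS: **`Sop_eq_scalarOp`** `Sop R (QuT T) a′ k = ScalarCovariantLaplacian.scalarOp n_k M a′ (R k) (T k)` (leaf-01's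
   `covGrad_conjTranspose_mul_covGrad`), **`Sop_one_eq`** `Sop 1 Q1 a′ k = DeltaPs n_k M a′ ⊗ₖ 1` (`scalarOp_one`), `Gop_one_eq`
   (`= Gps ⊗ₖ 1`), **`Sop_eq_add_scalarPert`** `Sop R (QuT T) a′ k = DeltaPs ⊗ₖ 1 + (1:ℂ) • scalarPert …` (the shape
   `BackgroundResolventLaw.perturbed_injected_law` wants), `Bs_eq_Qiso_kron`, **`gram_one_eq`** `Q1·G′_1·G′_1·Q1ᴴ = Kcomp ⊗ₖ 1` (leaf-09's
   `Kcomp_eq_iso`) hence **`unitDatum_one`**: `K_{1,k}` invertible and `‖N_{1,k}‖ ≤ σ₀⁻²` (`isUnit_det_Kcomp`, `opNorm_Kcomp_inv_le`) — the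
   `U = 1` unit datum of `perturbationLaws_gaugeTerm`; **`QsOp_mul_Qavg0`** (`Q′_N·Q₀ = Q′_{RN}`, nesting of block means), **`Bs_succ_mul_J0`**
   `Bs o n_{k+1} M · J0 k = Bs o n_k M` (the averaging/planting pairing is EXACT), `J0_mul_siteMul` (`J0·siteMul T = siteMul (T ∘ par)·J0`);
 * §3 (v1.1) the PAIRINGS read off §2: **`pairing_Q1`** `Q1 (k+1)·J0 k − Q1 k = 0`, `opNorm_J0_le : ‖J0 k‖ ≤ 1`, `QuT_succ_mul_J0_sub`
   `QuT T (k+1)·J0 k − QuT T k = B_{k+1}·(siteMul (T (k+1)) − siteMul (T k ∘ par))·J0 k`, hence **`pairing_QuT_le`**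
   `‖QuT T (k+1)·J0 k − QuT T k‖ ≤ ‖siteMul (T (k+1)) − siteMul (T k ∘ par)‖` (the transported averaging's two-level pairing defect is
   the one-step site-transport mismatch, sandwiched between contractions).
The two `LayerLaws` bundles themselves are produced in file 2 (`GaugeTermInstance`: `layerLaws_of_scalarLaws` for a general family from
the scalar tower's `FreeTowerLaws`/`PerturbationLaws` + coercivity `GaugeTermCoercivity` + leaf-10's `planting_number_le`,
`perturbationLaws_free_scalar` for the free family, END `perturbationLaws_gaugeTerm_balaban`); v1 of this docstring announced a
`layerLaws_free`/`LayerLaws.mono_consts` HERE — they were filed THERE under those names instead (DOCFIX-1 of the row-X cross-read,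
CLAIMS.log l.7140, discharged by this v1.1: docstring repointed, the two announced pairing statements appended; §1–§2 byte-identical).

HONEST FRAMING (T4-DAG p. 1).  Bookkeeping OURS; transporters `R`, site transporters `T`, the mass `a′` are DATA; the `U = 1` scalar tower laws
enter as a HYPOTHESIS in the tree's `FreeTowerLaws` shape (row B4.d supplies the instance; nothing printed is a hypothesis); model level, no
assertion of the dictionary B0 (trigger c5); finite torus, linear layer, operator norm; NOT [B9] (3.23)–(3.26) as printed; NE2 NOT proved; NOT
infinite volume, NOT a mass gap, NOT Clay, NOT summit progress; spine 0/9 unchanged.  HONEST DEPENDENCY: continuum YM on T⁴ ⇐ BetaPertH ∧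
nine spine estimates (0/9 proved); BetaPertH ⇐ (D1) ∧ (D4) ∧ CAP+tail; G-an2-4 gates asym, D1 and NE2/3/4.  ABSOLUTE RULE kept; no `sorry`.
-/

noncomputable section

open scoped BigOperators ComplexConjugate Matrix Matrix.Norms.L2Operator Kronecker ComplexOrder

namespace Summit.QuantumFields.BalabanUV.T4Continuum.GaugeTermScalarData

open Literature.MathematicalPhysics.QuantumFieldTheory.Balaban1983to89.B5Prop11Plancherel
open Literature.MathematicalPhysics.QuantumFieldTheory.Balaban1983to89.B5G183RateUnitTower (lev lev_neZero)
open Literature.MathematicalPhysics.QuantumFieldTheory.Balaban1983to89.B5Action121 (GradOp)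
open Literature.MathematicalPhysics.QuantumFieldTheory.Balaban1983to89.B5Block118 (QsOp)
open Literature.MathematicalPhysics.QuantumFieldTheory.Balaban1983to89.B5Blocks16 (blockOf)
open Summit.QuantumFields.BalabanUV.T4Continuum
open Summit.QuantumFields.BalabanUV.T4Continuum.BalabanAveragedTowerUnit (idx calGlev one_le_lev' cast_lev' lev_succ')
open Summit.QuantumFields.BalabanUV.T4Continuum.BackgroundResolventTower
open Summit.QuantumFields.BalabanUV.T4Continuum.CoerciveInverseTower (Coercive)
open Summit.QuantumFields.BalabanUV.T4Continuum.KingPairingPlantedLaw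
open Summit.QuantumFields.BalabanUV.T4Continuum.KroneckerLift
open Summit.QuantumFields.BalabanUV.T4Continuum.BlockMultiplication
open Summit.QuantumFields.BalabanUV.T4Continuum.BlockPairingGeometry (parT)
open Summit.QuantumFields.BalabanUV.T4Continuum.NE2ColourPerturbedLayer (inv_calDalev_kron opNorm_inv_calDalev_kron_le)
open Summit.QuantumFields.BalabanUV.T4Continuum.GaugeTermDecomposition (covGrad defect covGrad_eq covGrad_one defect_one connL)
open Summit.QuantumFields.BalabanUV.T4Continuum.GaugeTermSandwichBound (scalOp Zop Nop projP)
open Summit.QuantumFields.BalabanUV.T4Continuum.GaugeTermSandwichLaw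
open Summit.QuantumFields.BalabanUV.T4Continuum.GaugeTermLayer
open Summit.QuantumFields.BalabanUV.T4Continuum.GaugeTermPerturbationLaw (oneR)
open Summit.QuantumFields.BalabanUV.T4Continuum.GaugeTermCoercivity
open Summit.QuantumFields.BalabanUV.T4Continuum.ScalarBlockPoincare (PiS QsOp_apply_blockOf)
open Summit.QuantumFields.BalabanUV.T4Continuum.ScalarAveragedPropagator (DeltaPs Gps gammaPs gammaPs_pos isUnit_det_DeltaPs opNorm_Gps_le
  re_form_DeltaPs_ge DeltaPs_isHermitian)
open Summit.QuantumFields.BalabanUV.T4Continuum.ScalarAveragedCompression (Qiso Kcomp sigma0 sigma0_pos isUnit_det_Kcomp opNorm_Kcomp_inv_le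
  Kcomp_eq_iso)
open Summit.QuantumFields.BalabanUV.T4Continuum.ScalarCovariantLaplacian (Bs scalarOp scalarPert scalarOp_one opNorm_Bs_le
  covGrad_conjTranspose_mul_covGrad)
open Summit.QuantumFields.BalabanUV.T4Continuum.ScalarBlockPlanting (Qavg0 JK0 sqrt_smul_Qavg0_mul_JK0 opNorm_JK0_le)
open Summit.QuantumFields.BalabanUV.T4Continuum.ScalarPlantingDefect (mul_Qavg0_apply blockOf_par)
open Summit.QuantumFields.BalabanUV.T4Continuum.BalabanAveragedTowerModes (par)
open Summit.QuantumFields.BalabanUV.T4Continuum.CovariantDivergencePlantingTower (JK0T Pi0T JK0T_eq Pi0T_eq planting_number_le)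

variable {d : ℕ} (L : ℕ) [NeZero L] (M : Fin d → ℕ) [hM : ∀ μ, NeZero (M μ)] (a : ℝ) (ha : 0 < a)
variable (o : Type*) [Fintype o] [DecidableEq o]

/-! ## §1 The data -/

/-- Bałaban's TRANSPORTED scalar averaging at level `k`, `Q′(U_k) = B_k·siteMul (T k)` with `B_k = √(n_k^d)·(Q′_k ⊗ 1)` (leaf-01's `Bs`)
and site transporters `T k x ∈ M_o(ℂ)` (DATA; [Balaban1985BackgroundPropagators] (3.19) p.393, shape). [folklore] -/
def QuT (T : (k : ℕ) → Tor (fine (lev L k) M) → Matrix o o ℂ) (k : ℕ) : Matrix (Tor M × o) (Tor (fine (lev L k) M) × o) ℂ :=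
  Bs o (lev L k) M * siteMul (T k)

/-- the FREE scalar averaging `Q′_1,k = B_k`. [folklore] -/
def Q1 (k : ℕ) : Matrix (Tor M × o) (Tor (fine (lev L k) M) × o) ℂ := Bs o (lev L k) M

/-- King's 0-form planting along the tower, colour-lifted: `J₀ k = JK0T L M k ⊗ 1`. [folklore] -/
def J0 (k : ℕ) : Matrix (Tor (fine (lev L (k + 1)) M) × o) (Tor (fine (lev L k) M) × o) ℂ := JK0T L M k ⊗ₖ (1 : Matrix o o ℂ)

variable {o}

/-- `QuT` at trivial transport is `Q1`. [folklore] -/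
theorem QuT_one : QuT L M o (fun k (_ : Tor (fine (lev L k) M)) => (1 : Matrix o o ℂ)) = Q1 L M o := by
  funext k
  rw [QuT, Q1, siteMul_one, Matrix.mul_one]

/-! ## §2 Exact identifications with the suppliers' objects -/

variable (R : (k : ℕ) → Fin d → (Tor (fine (lev L k) M) → Matrix o o ℂ)) (T : (k : ℕ) → Tor (fine (lev L k) M) → Matrix o o ℂ) (a' : ℝ)

/-- **`Sop R (QuT T) a′ k = scalarOp n_k M a′ (R k) (T k)`** — my layer operator IS leaf-01's scalar operator (row B4.e). [folklore] -/
theorem Sop_eq_scalarOp (k : ℕ) : Sop L M R (QuT L M o T) a' k = scalarOp (lev L k) M a' (R k) (T k) := by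
  rw [Sop, scalOp, covGrad_conjTranspose_mul_covGrad, scalarOp, QuT]

/-- **`Sop 1 Q1 a′ k = DeltaPs n_k M a′ ⊗ 1`** — the free layer operator IS leaf-09's `U = 1` scalar operator, lifted (row B4.c). [folklore] -/
theorem Sop_one_eq (k : ℕ) : Sop L M (oneR L M (o := o)) (Q1 L M o) a' k = DeltaPs (lev L k) M a' ⊗ₖ (1 : Matrix o o ℂ) := by
  have h := Sop_eq_scalarOp L M (oneR L M (o := o)) (fun k (_ : Tor (fine (lev L k) M)) => (1 : Matrix o o ℂ)) a' k
  rw [QuT_one] at h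
  rw [h]
  exact scalarOp_one (lev L k) M a'

/-- `Gop 1 Q1 a′ k = Gps n_k M a′ ⊗ 1`. [folklore] -/
theorem Gop_one_eq (k : ℕ) : Gop L M (oneR L M (o := o)) (Q1 L M o) a' k = Gps (lev L k) M a' ⊗ₖ (1 : Matrix o o ℂ) := by
  rw [Gop, Sop_one_eq, kron_inv, Gps]

/-- **`Sop R (QuT T) a′ k = DeltaPs ⊗ 1 + (1:ℂ)•scalarPert`** — the `D + t•P` shape of `BackgroundResolventLaw` at `t = 1`. [folklore] -/
theorem Sop_eq_add_scalarPert (k : ℕ) :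
    Sop L M R (QuT L M o T) a' k = DeltaPs (lev L k) M a' ⊗ₖ (1 : Matrix o o ℂ) + (1 : ℂ) • scalarPert (lev L k) M a' (R k) (T k) := by
  rw [Sop_eq_scalarOp, scalarPert, one_smul, add_sub_cancel]

omit hM [Fintype o] in
/-- `B_k = Qiso ⊗ 1` (leaf-09's normalised scalar averaging, colour-lifted). [folklore] -/
theorem Bs_eq_Qiso_kron (n : ℕ) [NeZero n] : Bs o n M = Qiso n M ⊗ₖ (1 : Matrix o o ℂ) := by
  rw [Bs, Qiso, Matrix.smul_kronecker]

/-- **`Q1·G′_1·G′_1·Q1ᴴ = Kcomp ⊗ 1`** — the free unit-layer Gram IS leaf-09's compression `Kcomp`, lifted. [folklore] -/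
theorem gram_one_eq (k : ℕ) :
    Q1 L M o k * Gop L M (oneR L M (o := o)) (Q1 L M o) a' k * Gop L M (oneR L M (o := o)) (Q1 L M o) a' k * (Q1 L M o k)ᴴ
      = Kcomp (lev L k) M a' ⊗ₖ (1 : Matrix o o ℂ) := by
  rw [Gop_one_eq, Q1, Bs_eq_Qiso_kron, kron_conjTranspose, ← kron_mul, ← kron_mul, ← kron_mul, (Kcomp_eq_iso (lev L k) M).1]

/-- **THE `U = 1` UNIT DATUM** of `perturbationLaws_gaugeTerm`: every `K_{1,k}` is invertible and `‖N_{1,k}‖ ≤ σ₀⁻²` (leaf-09's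
`isUnit_det_Kcomp`, `opNorm_Kcomp_inv_le`). [folklore] -/
theorem unitDatum_one (ha' : 0 < a') (k : ℕ) :
    IsUnit (Q1 L M o k * Gop L M (oneR L M (o := o)) (Q1 L M o) a' k * Gop L M (oneR L M (o := o)) (Q1 L M o) a' k * (Q1 L M o k)ᴴ).det
      ∧ ‖Nt L M (oneR L M (o := o)) (Q1 L M o) a' k‖ ≤ ((sigma0 d a') ^ 2)⁻¹ := by
  refine ⟨by rw [gram_one_eq]; exact isUnit_det_kron o (isUnit_det_Kcomp (lev L k) M ha'), ?_⟩
  rw [Nt, Nop, gram_one_eq, kron_inv]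
  exact opNorm_kron_le_of_le o (opNorm_Kcomp_inv_le (lev L k) M ha')

/-- **NESTING OF BLOCK MEANS** `Q′_N·Q₀ = Q′_{RN}`: averaging the `R`-block means over `N`-blocks is the `RN`-block mean
([Balaban1984PropagatorsI] (1.16)–(1.18) p.20, scalar case; cf. `B5Composition116.QsOp_comp`). [folklore] -/
theorem QsOp_mul_Qavg0 (N R' : ℕ) [NeZero N] [NeZero R'] : QsOp N M * Qavg0 N R' M = QsOp (R' * N) M := by
  ext y x'
  rw [mul_Qavg0_apply, QsOp_apply_blockOf, QsOp_apply_blockOf, blockOf_par]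
  by_cases h : blockOf (R' * N) M x' = y
  · rw [if_pos h, if_pos h]; push_cast; rw [mul_pow]; field_simp
  · rw [if_neg h, if_neg h, mul_zero]

/-- `Q′_{RN}·J₀ = (√(R^d))⁻¹·Q′_N`. [folklore] -/
theorem QsOp_succ_mul_JK0 (N R' : ℕ) [NeZero N] [NeZero R'] :
    QsOp (R' * N) M * JK0 N R' M = ((((Real.sqrt ((R' : ℝ) ^ d)) : ℝ) : ℂ))⁻¹ • QsOp N M := by
  have hpos : 0 < Real.sqrt ((R' : ℝ) ^ d) := Real.sqrt_pos.mpr (pow_pos (Nat.cast_pos.mpr (Nat.pos_of_ne_zero (NeZero.ne R'))) d)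
  have hs : ((((Real.sqrt ((R' : ℝ) ^ d)) : ℝ) : ℂ)) ≠ 0 := Complex.ofReal_ne_zero.mpr hpos.ne'
  have h1 : Qavg0 N R' M * JK0 N R' M = ((((Real.sqrt ((R' : ℝ) ^ d)) : ℝ) : ℂ))⁻¹ • (1 : Matrix (Tor (fine N M)) (Tor (fine N M)) ℂ) := by
    have h := sqrt_smul_Qavg0_mul_JK0 N R' M
    rw [add_zero] at h
    rw [← h, smul_smul, inv_mul_cancel₀ hs, one_smul]
  rw [← QsOp_mul_Qavg0 M N R', Matrix.mul_assoc, h1, Matrix.mul_smul, Matrix.mul_one]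

/-- **`B_{k+1}·J₀ = B_k`** — the averaging/planting pairing is EXACT for the free scalar averaging. [folklore] -/
theorem Bs_succ_mul_J0 (k : ℕ) : Bs o (lev L (k + 1)) M * J0 L M o k = Bs o (lev L k) M := by
  have hL : (0 : ℝ) < L := Nat.cast_pos.mpr (Nat.pos_of_ne_zero (NeZero.ne L))
  have hsL : ((((Real.sqrt ((L : ℝ) ^ d)) : ℝ) : ℂ)) ≠ 0 := Complex.ofReal_ne_zero.mpr (Real.sqrt_pos.mpr (pow_pos hL d)).ne'
  have e : QsOp (lev L (k + 1)) M * JK0T L M k = ((((Real.sqrt ((L : ℝ) ^ d)) : ℝ) : ℂ))⁻¹ • QsOp (lev L k) M := by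
    rw [JK0T_eq, CovariantDivergencePlantingBound.JK0_eq_planting]
    exact QsOp_succ_mul_JK0 M (lev L k) L
  unfold J0
  rw [Bs, Bs, Matrix.smul_mul, ← kron_mul, e, Matrix.smul_kronecker, smul_smul]
  congr 1
  rw [cast_lev', cast_lev', pow_succ, mul_pow, Real.sqrt_mul (pow_nonneg (pow_nonneg hL.le k) d), Complex.ofReal_mul]
  field_simp

/-- `J₀·siteMul T = siteMul (T ∘ par)·J₀` (King's 0-form planting intertwines site multiplications). [folklore] -/
theorem J0_mul_siteMul (k : ℕ) (w : Tor (fine (lev L k) M) → Matrix o o ℂ) :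
    J0 L M o k * siteMul w = siteMul (fun x' : Tor (fine (lev L (k + 1)) M) => w (par (lev L k) L M x')) * J0 L M o k := by
  unfold J0
  rw [JK0T_eq]
  refine kron_mul_siteMul_eq fun i j hij => ?_
  have hpar : par (lev L k) L M i = j := by
    by_contra hne
    exact hij (by simp [CovariantDivergencePlanting.JK0, hne])
  rw [← hpar]

/-! ## §3 The averaging/planting pairings (v1.1) -/

/-- **`pairing_Q1`**: `Q1 (k+1)·J₀ k − Q1 k = 0` — the FREE scalar averaging pairs EXACTLY with King's 0-form planting
(`Bs_succ_mul_J0`). [folklore] -/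
theorem pairing_Q1 (k : ℕ) : Q1 L M o (k + 1) * J0 L M o k - Q1 L M o k = 0 := by
  rw [Q1, Q1, Bs_succ_mul_J0, sub_self]

/-- `‖J₀ k‖ ≤ 1` (King's 0-form planting is a partial isometry; leaf-04's `opNorm_JK0_le`, colour-lifted). [folklore] -/
theorem opNorm_J0_le (k : ℕ) : ‖J0 L M o k‖ ≤ 1 := by
  unfold J0
  rw [JK0T_eq, CovariantDivergencePlantingBound.JK0_eq_planting]
  exact opNorm_kron_le_of_le o (opNorm_JK0_le (lev L k) L M)

/-- **`QuT_succ_mul_J0_sub`** — the transported averaging's two-level pairing defect FACTORISES through the one-step site-transport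
mismatch: `Q′(U)_{k+1}·J₀ k − Q′(U)_k = B_{k+1}·(siteMul (T (k+1)) − siteMul (T k ∘ par))·J₀ k` (`Bs_succ_mul_J0`, `J0_mul_siteMul`).
[folklore] -/
theorem QuT_succ_mul_J0_sub (k : ℕ) :
    QuT L M o T (k + 1) * J0 L M o k - QuT L M o T k
      = Bs o (lev L (k + 1)) M
          * (siteMul (T (k + 1)) - siteMul (fun x' : Tor (fine (lev L (k + 1)) M) => T k (par (lev L k) L M x')))
          * J0 L M o k := by
  have h2 : QuT L M o T k
      = Bs o (lev L (k + 1)) M * siteMul (fun x' : Tor (fine (lev L (k + 1)) M) => T k (par (lev L k) L M x')) * J0 L M o k := by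
    rw [QuT, ← Bs_succ_mul_J0 L M (o := o) k, Matrix.mul_assoc, J0_mul_siteMul, ← Matrix.mul_assoc]
  rw [h2, QuT, Matrix.mul_assoc, Matrix.mul_assoc, ← Matrix.mul_sub, ← Matrix.sub_mul, ← Matrix.mul_assoc]

/-- **`pairing_QuT_le`**: `‖Q′(U)_{k+1}·J₀ k − Q′(U)_k‖ ≤ ‖siteMul (T (k+1)) − siteMul (T k ∘ par)‖` — the pairing defect of Bałaban's
transported scalar averaging against King's 0-form planting is controlled by the one-step site-transport mismatch ALONE
(`‖B_{k+1}‖ ≤ 1`, `‖J₀ k‖ ≤ 1`); at `T ≡ 1` the right-hand side is `0` (`pairing_Q1`). [folklore] -/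
theorem pairing_QuT_le (k : ℕ) :
    ‖QuT L M o T (k + 1) * J0 L M o k - QuT L M o T k‖
      ≤ ‖siteMul (T (k + 1)) - siteMul (fun x' : Tor (fine (lev L (k + 1)) M) => T k (par (lev L k) L M x'))‖ := by
  rw [QuT_succ_mul_J0_sub]
  have h1 : ‖Bs o (lev L (k + 1)) M‖ ≤ 1 := opNorm_Bs_le o (lev L (k + 1)) M
  have h2 : ‖J0 L M o k‖ ≤ 1 := opNorm_J0_le L M k
  set X := siteMul (T (k + 1)) - siteMul (fun x' : Tor (fine (lev L (k + 1)) M) => T k (par (lev L k) L M x'))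
  calc ‖Bs o (lev L (k + 1)) M * X * J0 L M o k‖ ≤ ‖Bs o (lev L (k + 1)) M * X‖ * ‖J0 L M o k‖ := Matrix.l2_opNorm_mul _ _
    _ ≤ (‖Bs o (lev L (k + 1)) M‖ * ‖X‖) * 1 := mul_le_mul (Matrix.l2_opNorm_mul _ _) h2 (norm_nonneg _) (by positivity)
    _ ≤ (1 * ‖X‖) * 1 := by gcongr
    _ = ‖X‖ := by ring

end Summit.QuantumFields.BalabanUV.T4Continuum.GaugeTermScalarData

end
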